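import Mathlib.Topology.Instances.RealVectorSpace
import Literature.IUT.LogThetaLattice.ArchMonoAnalyticLogShellSigns
import HarnessLib

/-!
# [IUTchIII] Proposition 1.2 (vii): WHY the archimedean poly-isomorphism is a `{±1} × {±1}`-orbit — the
# factorwise symmetries of `k~(G) = C~ × C~` preserving the log-shell are exactly the four sign maps
# (proof-only companion to `ArchMonoAnalyticLogShellSigns.lean`)

Mochizuki, *Inter-universal Teichmüller Theory III*, kurims manuscript (May 2020), §1, Prop 1.2 (vii), p.33 l.8–22
[claim: Mochizuki2012, status: disputed] (D-0012 claim key; record-only: the content typed here is elementary real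
analysis; this file takes no side on anything). Discharge-wave companion (abc-iut cell, block C / W6, node
`IUTchIII:Prop1.2(vii)`), continuing `ArchMonoAnalyticLogShellSigns.lean` (p428905), which PROVED that the four sign
maps `z ↦ u·Re z + i·v·Im z` (`u, v ∈ {±1}`) — "an orbit of isomorphisms with respect to the independent actions of
`{±1}` on each of the direct factors that occur in the construction of [AbsTopIII], Proposition 5.8, (v)" — are
compatible with the log-shell, the radial / angular log-volumes and the metrics.

This file proves the CONVERSE that explains the printed bracket: the indeterminacy IS `{±1}` per direct factor.
* `prop12vii_continuous_addMonoidHom_real_apply`: a continuous additive endomorphism of the real line `C~ ≅ ℝ` is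
  `x ↦ c·x` (Mathlib `map_real_smul`);
* `prop12vii_eq_sign_of_image_coreSegment`: if `x ↦ c·x` maps the core segment `ℐ_{C~} = [-π, π]` ([AbsTopIII]
  Prop 5.8 (v): "the unique compact line segment on `C~` that is invariant with respect to the action of `±1` and
  maps bijectively, except for its endpoints, to `C^×`") onto itself then `c = ±1`; hence
  (`prop12vii_coreSegment_symmetries`) the continuous additive symmetries of `(C~, ℐ_{C~})` are exactly `±1` —
  the "action of `{±1}`" on ONE direct factor;
* `prop12vii_factorwise_logShell_symmetries`: in the `ℂ`-model `k~ = ℝ × ℝ ⥲ ℂ`, a map respecting the two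
  direct factors, `z ↦ f(Re z) + i·g(Im z)` with `f, g` continuous additive, maps the log-shell
  `I_k = arcLogShell = {|a| ≤ π}` onto itself IF AND ONLY IF it is one of the four sign maps of
  `ArchMonoAnalyticLogShellSigns.lean` — so the printed poly-isomorphism is the FULL set of factorwise topological-
  module isomorphisms compatible with the log-shells, and it is a `{±1} × {±1}`-torsor (`prop12vii_signC_injective`:
  the four maps are pairwise distinct);
* `prop12vii_rotation_image_arcLogShell`: by contrast, WITHOUT the direct-factor structure every rotation
  `z ↦ w·z`, `|w| = 1`, also preserves the log-shell (and the radial / angular volumes, [AbsTopIII] Prop 5.7 (ii)(b):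
  `ComplexVolume.radialLogVolume_smul_of_norm_eq_one`, `angularVolume_smul`) — the direct factors of Prop 5.8 (v)
  are what cut the indeterminacy down from `S¹ ⋊ {±1}` to `{±1} × {±1}`.
No new mathematics; no definition; no named fact. Typed ≠ endorsed.
-/

set_option autoImplicit false

namespace Literature.IUT.LogThetaLattice

open Complex
open scoped ComplexConjugate Pointwise
open Literature.AnabelianGeometry.AbsoluteAnabelian

/-! ### 1. One direct factor: the symmetries of `(C~, ℐ_{C~}) = (ℝ, [-π, π])` are `±1` -/

/-- **IUTchIII:Prop1.2(vii)** (kurims p.33; [AbsTopIII] Prop 5.8 (iv) p.140 "we regard `C~` as a topological group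
[isomorphic to `ℝ`]") a continuous additive endomorphism of the real line is multiplication by the constant `f(1)`.
[claim: Mochizuki2012, status: disputed] -/
theorem prop12vii_continuous_addMonoidHom_real_apply (f : ℝ →+ ℝ) (hf : Continuous f) (x : ℝ) :
    f x = f 1 * x := by
  have h := map_real_smul f hf x 1
  rw [smul_eq_mul, mul_one, smul_eq_mul] at h
  rw [h, mul_comm]

/-- **IUTchIII:Prop1.2(vii)** (kurims p.33; [AbsTopIII] Prop 5.8 (v) p.140) if multiplication by `c` maps the core
segment `ℐ_{C~} = [-π, π]` onto itself, then `c = ±1`. [claim: Mochizuki2012, status: disputed] -/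
theorem prop12vii_eq_sign_of_image_coreSegment {c : ℝ}
    (h : (fun x : ℝ => c * x) '' ComplexLogShell.coreSegment = ComplexLogShell.coreSegment) :
    c = 1 ∨ c = -1 := by
  have hpi : Real.pi ∈ ComplexLogShell.coreSegment := ⟨by linarith [Real.pi_pos], le_rfl⟩
  -- `c·π ∈ [-π, π]` gives `|c| ≤ 1`
  have h1 : c * Real.pi ∈ ComplexLogShell.coreSegment := h ▸ ⟨Real.pi, hpi, rfl⟩
  have hle : |c| ≤ 1 := by
    have : |c * Real.pi| ≤ Real.pi := abs_le.mpr h1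
    rw [abs_mul, abs_of_pos Real.pi_pos] at this
    nlinarith [Real.pi_pos]
  -- `π = c·x` with `x ∈ [-π, π]` gives `1 ≤ |c|`
  obtain ⟨x, hx, hcx⟩ : Real.pi ∈ (fun x : ℝ => c * x) '' ComplexLogShell.coreSegment := h.symm ▸ hpi
  have hge : 1 ≤ |c| := by
    have hxle : |x| ≤ Real.pi := abs_le.mpr hx
    have hcx' : c * x = Real.pi := hcx
    have habs : |c| * |x| = Real.pi := by rw [← abs_mul, hcx', abs_of_pos Real.pi_pos]
    nlinarith [Real.pi_pos, abs_nonneg c, abs_nonneg x]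
  have habs : |c| = 1 := le_antisymm hle hge
  rcases abs_eq (zero_le_one' ℝ) |>.mp habs with h | h
  · exact Or.inl h
  · exact Or.inr h

/-- **IUTchIII:Prop1.2(vii)** (kurims p.33; [AbsTopIII] Prop 5.8 (v) p.140) the "action of `{±1}`" on one direct
factor is the FULL symmetry group: a continuous additive map of `C~ = ℝ` mapping the core segment `ℐ_{C~}` onto itself
is `x ↦ x` or `x ↦ -x`. [claim: Mochizuki2012, status: disputed] -/
theorem prop12vii_coreSegment_symmetries (f : ℝ →+ ℝ) (hf : Continuous f)
    (h : f '' ComplexLogShell.coreSegment = ComplexLogShell.coreSegment) :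
    (∀ x, f x = x) ∨ (∀ x, f x = -x) := by
  have hf' : (f : ℝ → ℝ) = fun x => f 1 * x := funext (prop12vii_continuous_addMonoidHom_real_apply f hf)
  rw [hf'] at h
  rcases prop12vii_eq_sign_of_image_coreSegment h with h1 | h1
  · exact Or.inl fun x => by rw [prop12vii_continuous_addMonoidHom_real_apply f hf, h1, one_mul]
  · exact Or.inr fun x => by rw [prop12vii_continuous_addMonoidHom_real_apply f hf, h1, neg_one_mul]

/-! ### 2. Both direct factors: the factorwise symmetries of `(k~, I_k) = (ℂ, {|a| ≤ π})` are the four sign maps -/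

/-- **IUTchIII:Prop1.2(vii)** (kurims p.33) if the factorwise scaling `z ↦ c₁·Re z + i·c₂·Im z` maps the log-shell
`I_k = {|a| ≤ π}` onto itself then `c₁ = ±1` and `c₂ = ±1`. [claim: Mochizuki2012, status: disputed] -/
theorem prop12vii_eq_signs_of_image_arcLogShell {c₁ c₂ : ℝ}
    (h : (fun z : ℂ => (⟨c₁ * z.re, c₂ * z.im⟩ : ℂ)) '' arcLogShell = arcLogShell) :
    (c₁ = 1 ∨ c₁ = -1) ∧ (c₂ = 1 ∨ c₂ = -1) := by
  have mem_iff : ∀ z : ℂ, z ∈ arcLogShell ↔ ‖z‖ ≤ Real.pi := fun z => Iff.rfl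
  -- the real direct factor: restrict to the real axis
  have h₁ : (fun x : ℝ => c₁ * x) '' ComplexLogShell.coreSegment = ComplexLogShell.coreSegment := by
    apply Set.Subset.antisymm
    · rintro _ ⟨x, hx, rfl⟩
      have hxC : ((x : ℝ) : ℂ) ∈ arcLogShell := by
        rw [mem_iff, Complex.norm_real, Real.norm_eq_abs]; exact abs_le.mpr hx
      have himg : (⟨c₁ * ((x : ℝ) : ℂ).re, c₂ * ((x : ℝ) : ℂ).im⟩ : ℂ) ∈ arcLogShell := h ▸ ⟨_, hxC, rfl⟩
      rw [mem_iff, Complex.ofReal_re, Complex.ofReal_im, mul_zero] at himg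
      have : ‖(⟨c₁ * x, 0⟩ : ℂ)‖ = |c₁ * x| := by
        rw [show (⟨c₁ * x, 0⟩ : ℂ) = ((c₁ * x : ℝ) : ℂ) from rfl, Complex.norm_real, Real.norm_eq_abs]
      rw [this] at himg
      exact abs_le.mp himg
    · intro x hx
      have hxC : ((x : ℝ) : ℂ) ∈ arcLogShell := by
        rw [mem_iff, Complex.norm_real, Real.norm_eq_abs]; exact abs_le.mpr hx
      obtain ⟨z, hz, hzx⟩ : ((x : ℝ) : ℂ) ∈ (fun z : ℂ => (⟨c₁ * z.re, c₂ * z.im⟩ : ℂ)) '' arcLogShell :=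
        h.symm ▸ hxC
      have hre : c₁ * z.re = x := by simpa using congrArg Complex.re hzx
      refine ⟨z.re, abs_le.mp ((Complex.abs_re_le_norm z).trans hz), hre⟩
  -- the imaginary direct factor: restrict to the imaginary axis
  have h₂ : (fun x : ℝ => c₂ * x) '' ComplexLogShell.coreSegment = ComplexLogShell.coreSegment := by
    apply Set.Subset.antisymm
    · rintro _ ⟨x, hx, rfl⟩
      have hxC : ((x : ℝ) : ℂ) * I ∈ arcLogShell := by
        rw [mem_iff, norm_mul, Complex.norm_real, Complex.norm_I, mul_one, Real.norm_eq_abs]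
        exact abs_le.mpr hx
      have himg : (⟨c₁ * (((x : ℝ) : ℂ) * I).re, c₂ * (((x : ℝ) : ℂ) * I).im⟩ : ℂ) ∈ arcLogShell :=
        h ▸ ⟨_, hxC, rfl⟩
      rw [mem_iff] at himg
      have hre0 : (((x : ℝ) : ℂ) * I).re = 0 := by simp
      have him0 : (((x : ℝ) : ℂ) * I).im = x := by simp
      rw [hre0, him0, mul_zero] at himg
      have : ‖(⟨0, c₂ * x⟩ : ℂ)‖ = |c₂ * x| := by
        rw [show (⟨0, c₂ * x⟩ : ℂ) = ((c₂ * x : ℝ) : ℂ) * I from Complex.ext (by simp) (by simp), norm_mul,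
          Complex.norm_real, Complex.norm_I, mul_one, Real.norm_eq_abs]
      rw [this] at himg
      exact abs_le.mp himg
    · intro x hx
      have hxC : ((x : ℝ) : ℂ) * I ∈ arcLogShell := by
        rw [mem_iff, norm_mul, Complex.norm_real, Complex.norm_I, mul_one, Real.norm_eq_abs]
        exact abs_le.mpr hx
      obtain ⟨z, hz, hzx⟩ : ((x : ℝ) : ℂ) * I ∈ (fun z : ℂ => (⟨c₁ * z.re, c₂ * z.im⟩ : ℂ)) '' arcLogShell :=
        h.symm ▸ hxC
      have him : c₂ * z.im = x := by simpa using congrArg Complex.im hzx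
      exact ⟨z.im, abs_le.mp ((Complex.abs_im_le_norm z).trans hz), him⟩
  exact ⟨prop12vii_eq_sign_of_image_coreSegment h₁, prop12vii_eq_sign_of_image_coreSegment h₂⟩

/-- **IUTchIII:Prop1.2(vii)** (kurims p.33) a real sign `c = ±1` is the cast of a unit `u ∈ ℤˣ = {±1}`, acting as in
`ArchMonoAnalyticLogShellSigns.lean`. [claim: Mochizuki2012, status: disputed] -/
theorem prop12vii_exists_units_of_sign {c : ℝ} (hc : c = 1 ∨ c = -1) : ∃ u : ℤˣ, ∀ r : ℝ, u • r = c * r := by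
  rcases hc with rfl | rfl
  · exact ⟨1, fun r => by rw [one_smul, one_mul]⟩
  · exact ⟨-1, fun r => by rw [Units.neg_smul, one_smul, neg_one_mul]⟩

/-- **IUTchIII:Prop1.2(vii)** (kurims p.33) "a poly-isomorphism [i.e., an orbit of isomorphisms with respect to
the independent actions of `{±1}` on each of the direct factors …] … of topological modules … compatible with … the
respective log-shells" — the orbit is the FULL factorwise indeterminacy: in the `ℂ`-model a map respecting the two
direct factors `C~ × C~ = ℝ × ℝ`, `z ↦ f(Re z) + i·g(Im z)` with `f, g` continuous additive, maps the log-shell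
`I_k = {|a| ≤ π}` onto itself IF AND ONLY IF it is one of the four sign maps. [claim: Mochizuki2012, status: disputed] -/
theorem prop12vii_factorwise_logShell_symmetries (f g : ℝ →+ ℝ) (hf : Continuous f) (hg : Continuous g) :
    (fun z : ℂ => (⟨f z.re, g z.im⟩ : ℂ)) '' arcLogShell = arcLogShell ↔
      ∃ u v : ℤˣ, ∀ z : ℂ, (⟨f z.re, g z.im⟩ : ℂ) = ⟨u • z.re, v • z.im⟩ := by
  have hfg : (fun z : ℂ => (⟨f z.re, g z.im⟩ : ℂ)) = fun z : ℂ => (⟨f 1 * z.re, g 1 * z.im⟩ : ℂ) := by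
    funext z
    rw [prop12vii_continuous_addMonoidHom_real_apply f hf, prop12vii_continuous_addMonoidHom_real_apply g hg]
  constructor
  · intro h
    rw [hfg] at h
    obtain ⟨h₁, h₂⟩ := prop12vii_eq_signs_of_image_arcLogShell h
    obtain ⟨u, hu⟩ := prop12vii_exists_units_of_sign h₁
    obtain ⟨v, hv⟩ := prop12vii_exists_units_of_sign h₂
    refine ⟨u, v, fun z => ?_⟩
    rw [hu, hv, prop12vii_continuous_addMonoidHom_real_apply f hf,
      prop12vii_continuous_addMonoidHom_real_apply g hg]
  · rintro ⟨u, v, huv⟩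
    rw [show (fun z : ℂ => (⟨f z.re, g z.im⟩ : ℂ)) = fun z : ℂ => (⟨u • z.re, v • z.im⟩ : ℂ) from funext huv]
    exact prop12vii_signC_image_arcLogShell u v

/-- **IUTchIII:Prop1.2(vii)** (kurims p.33) the orbit is a `{±1} × {±1}`-TORSOR: distinct sign pairs give distinct
maps (the four isomorphisms of the poly-isomorphism are pairwise distinct). [claim: Mochizuki2012, status: disputed] -/
theorem prop12vii_signC_injective :
    Function.Injective fun uv : ℤˣ × ℤˣ => fun z : ℂ => (⟨uv.1 • z.re, uv.2 • z.im⟩ : ℂ) := by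
  rintro ⟨u, v⟩ ⟨u', v'⟩ h
  have h1 := congrArg Complex.re (congrFun h (1 : ℂ))
  have hI := congrArg Complex.im (congrFun h I)
  simp only [Complex.one_re, Complex.I_im, Units.smul_def, zsmul_eq_mul, mul_one, Int.cast_inj,
    Units.val_inj] at h1 hI
  rw [h1, hI]

/-! ### 3. Contrast: without the direct factors every rotation would qualify -/

/-- **IUTchIII:Prop1.2(vii)** (kurims p.33) by contrast, a rotation `z ↦ w·z` (`|w| = 1`) — which does NOT respect
the two direct factors unless `w = ±1` — also maps the log-shell `I_k` onto itself (and preserves the radial and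
angular log-volumes: [AbsTopIII] Prop 5.7 (ii)(b), `ComplexVolume.radialLogVolume_smul_of_norm_eq_one`,
`ComplexVolume.angularVolume_smul`); it is the direct-factor structure of [AbsTopIII] Prop 5.8 (v) that cuts the
indeterminacy down to `{±1} × {±1}`. [claim: Mochizuki2012, status: disputed] -/
theorem prop12vii_rotation_image_arcLogShell {w : ℂ} (hw : ‖w‖ = 1) : w • arcLogShell = arcLogShell := by
  have key : ∀ w : ℂ, ‖w‖ = 1 → w • arcLogShell ⊆ arcLogShell := by
    rintro w hw _ ⟨z, hz, rfl⟩
    show ‖w • z‖ ≤ Real.pi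
    rw [smul_eq_mul, norm_mul, hw, one_mul]
    exact hz
  refine (key w hw).antisymm fun z hz => ?_
  have hw0 : w ≠ 0 := fun h => by rw [h, norm_zero] at hw; exact zero_ne_one hw
  refine ⟨w⁻¹ • z, key w⁻¹ (by rw [norm_inv, hw, inv_one]) ⟨z, hz, rfl⟩, ?_⟩
  show w • w⁻¹ • z = z
  rw [smul_smul, mul_inv_cancel₀ hw0, one_smul]

/-- **IUTchIII:Prop1.2(vii)** (kurims p.33) … whereas a rotation respects the two direct factors (is of the form
`z ↦ c₁·Re z + i·c₂·Im z`) only if `w = ±1`: rotations other than `±1` move the real axis off itself.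
[claim: Mochizuki2012, status: disputed] -/
theorem prop12vii_rotation_factorwise_iff {w : ℂ} (hw : ‖w‖ = 1) :
    (∃ c₁ c₂ : ℝ, ∀ z : ℂ, w * z = ⟨c₁ * z.re, c₂ * z.im⟩) ↔ (w = 1 ∨ w = -1) := by
  constructor
  · rintro ⟨c₁, c₂, h⟩
    have him : w.im = 0 := by simpa using congrArg Complex.im (h 1)
    have hre : w.re = c₁ := by simpa using congrArg Complex.re (h 1)
    have hw' : |w.re| = 1 := by
      have := Complex.sq_norm w
      rw [Complex.normSq_apply, him, mul_zero, add_zero, hw, one_pow] at this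
      nlinarith [abs_mul_abs_self w.re, abs_nonneg w.re]
    rcases abs_eq (zero_le_one' ℝ) |>.mp hw' with h1 | h1
    · exact Or.inl (Complex.ext (by rw [h1, Complex.one_re]) (by rw [him, Complex.one_im]))
    · exact Or.inr (Complex.ext (by rw [h1, Complex.neg_re, Complex.one_re])
        (by rw [him, Complex.neg_im, Complex.one_im, neg_zero]))
  · rintro (rfl | rfl)
    · exact ⟨1, 1, fun z => Complex.ext (by simp) (by simp)⟩
    · exact ⟨-1, -1, fun z => Complex.ext (by simp) (by simp)⟩

end Literature.IUT.LogThetaLattice
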